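import Summits.ValiantsHypothesis.ValiantsHypothesis.Theorems.KPlusLogSqLawTropicalBTopHeavyCoreTransferSums

/-!
# Route «KPlusLogSqLaw», crux `TropicalB` (stmt-ValiantsHypothesis-19771) — THE NESTING LAW for two-valued dominant terms below a
# `c₀`-heavy top term, and the two-valued transfer law with ONE COUNTING HYPOTHESIS

HONEST FRAMING.  Helper file (cell `pub-symmetroid`, seat val-sym-trop-p1 g23, 2026-08-29; `--supports stmt-ValiantsHypothesis-19771 --as
helper`), sequel of …TopHeavyCoreTransferSums (same seat).  Census-STRUCTURE laws of the κ-programme (3-body obstructions on dominant terms of an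
arbitrary dominance design, all sizes `m`); nothing here bounds `TropicalB` in its window and nothing bears on `WeakLifting`, DoorA26 / DoorA34,
`MatrixDescartes` (stmt-ValiantsHypothesis-18050) or VP ≠ VNP.  As for every law sharing the `C`-histogram `c₀^{m−1}c₄` with CORE LAW C, no new
deficient census cell follows; the content is structural.

SETTING.  Classes `d c₀ < d c₁ < d c₂`; `P_C = (σC, λC)` with `λC ≡ c₀` off one column `c` (`d c₀ ≤ d (λC ·)`), the LATEST of three dominant
terms; `P_A = (σA, λA)` TWO-VALUED: `λA = c₁` on a column set `P`, `c₂` off `P`; `P_B = (σB, λB)` two-valued OFF ONE COLUMN `s`: `λB = c₁` on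
`Q`, `c₂` off `Q`, except at `s`, where `λB s` is any class with `d (λA s) < d (λB s)` and `d c₂ ≤ d (λB s)`.

* `transfer_twoValued_count` — if `#(P ∖ Q) + [s ∈ Q ∖ P] + 1 ≤ #(Q ∖ P) + [s ∈ P ∖ Q]` then the three are not all dominant.  ONE counting
  hypothesis; proof = `transfer_of_sums` with (A2) by the count «off `s`, `r = (d c₂ − d c₁)·([· ∈ P] − [· ∈ Q])`», (A3) with `L = P`, (B1)
  with `b = s`.
* `transfer_twoValued_ge` — the (2,2)→(1,3) shape with SURPLUS: `λB s = c₃` (`d c₂ < d c₃`), `s ∉ Q`, and `#P + 1 ≤ #Q + [s ∈ P]`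
  (`transfer_twoValued` of the previous file is `#Q = #P + 1`; new: any `#Q ≥ #P + 1`, i.e. `B = c₁^{a+t} c₂^{m−a−t−1} c₃`, `t ≥ 1`, every
  arrangement; and `#Q = #P` when the `c₃` sits on a `c₁`-column of `A` — the NON-aligned one-column transfer `B = A − c₂ + c₃`).
* `nested_of_dominant` — **NESTING LAW**: if `P_A`, `P_B` are BOTH two-valued (`λB = c₁` on `Q`, `c₂` off `Q`, no exceptional column),
  dominant, earlier than the `c₀`-heavy `P_C`, and `#P ≤ #Q`, then `P ⊆ Q`.  So below a later `c₀^{m−1}c₄`-term the `c₁`-supports of the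
  two-valued `{c₁,c₂}` dominant terms form a CHAIN under inclusion: the binary sub-odometer `c₁^a c₂^{m−a}`, `a = 0, 1, …` is filled by NESTED
  sets (no exchange of a `c₁`-column against a `c₂`-column is ever undone), whatever the permutations.
[this cell; combinatorics folklore]
-/

set_option linter.dupNamespace false
set_option autoImplicit false

namespace Summit.ValiantsHypothesis.ValiantsHypothesis.Theorems.KPlusLogSqLaw.TopHeavyCore

open Summit.ValiantsHypothesis.ValiantsHypothesis.Theorems.MatrixDescartes.Negative
open scoped BigOperators
open Finset

variable {m K : ℕ}

/-! ## 1. The counting inequality -/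

/-- the count behind (A2): for `j ∈ U`, `s ∉ U ∖ {j}` and `#(P ∖ Q) + [s ∈ Q ∖ P] + 1 ≤ #(Q ∖ P) + [s ∈ P ∖ Q]`,
`#(U∖{j} ∩ P) − #(U∖{j} ∩ Q) ≤ #Uᶜ − #(Uᶜ ∩ P)`. [folklore] -/
theorem count_A2 (U P Q : Finset (Fin m)) {j s : Fin m} (hjU : j ∈ U) (hsS : s ∉ U.erase j)
    (hcount : (P \ Q).card + (if s ∈ Q \ P then 1 else 0) + 1 ≤ (Q \ P).card + (if s ∈ P \ Q then 1 else 0)) :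
    ((U.erase j ∩ P).card : ℤ) - ((U.erase j ∩ Q).card : ℤ) ≤ ((Uᶜ).card : ℤ) - ((Uᶜ ∩ P).card : ℤ) := by
  classical
  have cP := card_split_erase U P hjU
  have cQ := card_split_erase U Q hjU
  have hPQ : ((P \ Q).card : ℤ) + ((P ∩ Q).card : ℤ) = P.card := by exact_mod_cast card_sdiff_add_card_inter P Q
  have hQP : ((Q \ P).card : ℤ) + ((P ∩ Q).card : ℤ) = Q.card := by
    rw [inter_comm]; exact_mod_cast card_sdiff_add_card_inter Q P
  have hQc : ((Uᶜ ∩ Q).card : ℤ) ≤ ((Uᶜ).card : ℤ) := by exact_mod_cast card_le_card inter_subset_left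
  have hcz : ((P \ Q).card : ℤ) + (if s ∈ Q \ P then (1 : ℤ) else 0) + 1 ≤ ((Q \ P).card : ℤ) + (if s ∈ P \ Q then (1 : ℤ) else 0) := by
    have h := hcount
    split_ifs at h ⊢ <;> omega
  have hjP0 : (0 : ℤ) ≤ (if j ∈ P then (1 : ℤ) else 0) := by split_ifs <;> norm_num
  have hjQ1 : (if j ∈ Q then (1 : ℤ) else 0) ≤ 1 := by split_ifs <;> norm_num
  have hsQP0 : (0 : ℤ) ≤ (if s ∈ Q \ P then (1 : ℤ) else 0) := by split_ifs <;> norm_num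
  rcases (show s = j ∨ s ∉ U by
      by_cases h : s = j
      · exact Or.inl h
      · exact Or.inr fun hsU => hsS (mem_erase.mpr ⟨h, hsU⟩)) with hsj | hsU
  · -- `s = j`: the indicator of `s ∈ P ∖ Q` is at most `[j ∈ P]·(1 − [j ∈ Q])`
    subst hsj
    have key : (if s ∈ P \ Q then (1 : ℤ) else 0) - (if s ∈ Q \ P then (1 : ℤ) else 0)
        - (if s ∈ P then (1 : ℤ) else 0) + (if s ∈ Q then (1 : ℤ) else 0) = 0 := by
      by_cases hP : s ∈ P <;> by_cases hQ : s ∈ Q <;> simp [hP, hQ, mem_sdiff]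
    linarith
  · -- `s ∈ Uᶜ`: if `s ∈ P ∖ Q` then `s` is a column of `Uᶜ` outside `Q`
    have key : ((Uᶜ ∩ Q).card : ℤ) + (if s ∈ P \ Q then (1 : ℤ) else 0) ≤ ((Uᶜ).card : ℤ) := by
      split_ifs with hPQ
      · have hsub : Uᶜ ∩ Q ⊆ (Uᶜ).erase s := by
          intro x hx
          rw [mem_erase]
          refine ⟨fun h => (mem_sdiff.mp hPQ).2 (h ▸ (mem_inter.mp hx).2), (mem_inter.mp hx).1⟩
        have h1 := card_le_card hsub
        rw [card_erase_of_mem (mem_compl.mpr hsU)] at h1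
        have h2 : 0 < (Uᶜ).card := card_pos.mpr ⟨s, mem_compl.mpr hsU⟩
        have : (Uᶜ ∩ Q).card + 1 ≤ (Uᶜ).card := by omega
        exact_mod_cast this
      · simpa using hQc
    linarith

/-! ## 2. The two-valued transfer law with one counting hypothesis -/

/-- **TWO-VALUED TRANSFER LAW, COUNTING FORM.**  See the module docstring. [this cell] -/
theorem transfer_twoValued_count (d : Fin K → ℕ) (v ε : Fin m → Fin m → Fin K → ℤ)
    {c₀ c₁ c₂ : Fin K} (h01 : d c₀ < d c₁) (h12 : d c₁ < d c₂)
    {σA σB σC : Equiv.Perm (Fin m)} {lA lB lC : Fin m → Fin K} {s c : Fin m} {P Q : Finset (Fin m)}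
    (hlA : ∀ x, lA x = if x ∈ P then c₁ else c₂) (hlB : ∀ x, x ≠ s → lB x = if x ∈ Q then c₁ else c₂)
    (hs : d (lA s) < d (lB s)) (hs2 : d c₂ ≤ d (lB s))
    (hcount : (P \ Q).card + (if s ∈ Q \ P then 1 else 0) + 1 ≤ (Q \ P).card + (if s ∈ P \ Q then 1 else 0))
    (hlC : ∀ x, x ≠ c → lC x = c₀) (hCge : ∀ x, d c₀ ≤ d (lC x))
    {θA θB θC : ℤ} (hA : IsDominant d v ε θA (σA, lA)) (hB : IsDominant d v ε θB (σB, lB)) (hC : IsDominant d v ε θC (σC, lC))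
    (hAC : θA < θC) (hBC : θB < θC) : False := by
  classical
  set e₀ : ℤ := (d c₀ : ℤ) with he₀
  set e₁ : ℤ := (d c₁ : ℤ) with he₁
  set e₂ : ℤ := (d c₂ : ℤ) with he₂
  have h01z : e₀ < e₁ := by rw [he₀, he₁]; exact_mod_cast h01
  have h12z : e₁ < e₂ := by rw [he₁, he₂]; exact_mod_cast h12
  have hAz : ∀ x, (d (lA x) : ℤ) = if x ∈ P then e₁ else e₂ := fun x => by rw [hlA x]; split_ifs <;> rfl
  have hBz : ∀ x, x ≠ s → (d (lB x) : ℤ) = if x ∈ Q then e₁ else e₂ := fun x hx => by rw [hlB x hx]; split_ifs <;> rfl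
  have hsz : (d (lA s) : ℤ) < d (lB s) := by exact_mod_cast hs
  have hs2z : e₂ ≤ d (lB s) := by rw [he₂]; exact_mod_cast hs2
  have hAge : ∀ x, e₁ ≤ d (lA x) := fun x => by rw [hAz x]; split_ifs <;> linarith
  have hAle : ∀ x, (d (lA x) : ℤ) ≤ e₂ := fun x => by rw [hAz x]; split_ifs <;> linarith
  have hBge : ∀ x, e₁ ≤ d (lB x) := fun x => by
    by_cases hx : x = s
    · rw [hx]; linarith [hAge s]
    · rw [hBz x hx]; split_ifs <;> linarith
  have hlowA : ∀ x, d c₀ < d (lA x) := fun x => by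
    have := hAge x; rw [he₁] at this; exact_mod_cast (show (d c₀ : ℤ) < d (lA x) by linarith)
  have hlowB : ∀ x, d c₀ < d (lB x) := fun x => by
    have := hBge x; rw [he₁] at this; exact_mod_cast (show (d c₀ : ℤ) < d (lB x) by linarith)
  have hr : ∀ x, x ≠ s → (d (lB x) : ℤ) - d (lA x) =
      (e₂ - e₁) * ((if x ∈ P then (1 : ℤ) else 0) - (if x ∈ Q then (1 : ℤ) else 0)) := by
    intro x hxs
    rw [hAz x, hBz x hxs]
    split_ifs <;> ring
  have hsur : ∀ x, (e₂ - e₁) * (if x ∈ P then (0 : ℤ) else 1) ≤ (d (lA x) : ℤ) - d c₀ := by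
    intro x; rw [hAz x, ← he₀]; split_ifs <;> linarith
  have hsur0 : ∀ x, (0 : ℤ) ≤ (d (lA x) : ℤ) - d c₀ := fun x => by
    have := hlowA x; have : (d c₀ : ℤ) ≤ d (lA x) := (by exact_mod_cast this.le); linarith
  -- a lowered column: some `y ∈ Q \ P`, `y ≠ s`
  obtain ⟨y, hyQ, hyP, hys⟩ : ∃ y, y ∈ Q ∧ y ∉ P ∧ y ≠ s := by
    by_contra h
    push Not at h
    have hsub : Q \ P ⊆ {s} := by
      intro x hx
      rw [mem_singleton]
      exact h x (mem_sdiff.mp hx).1 (mem_sdiff.mp hx).2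
    have h1 : (Q \ P).card ≤ (if s ∈ Q \ P then 1 else 0) := by
      split_ifs with hsm
      · exact (card_le_card hsub).trans (card_singleton s).le
      · have : Q \ P = ∅ := by
          apply eq_empty_of_forall_notMem
          intro x hx
          have hxs : x = s := mem_singleton.mp (hsub hx)
          exact hsm (hxs ▸ hx)
        rw [this, card_empty]
    have h2 : (if s ∈ P \ Q then 1 else 0) ≤ (P \ Q).card := by
      split_ifs with hsm
      · exact card_pos.mpr ⟨s, hsm⟩
      · exact Nat.zero_le _
    omega
  have hylow : d (lB y) < d (lA y) := by
    have h1 : (d (lB y) : ℤ) = e₁ := by rw [hBz y hys, if_pos hyQ]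
    have h2 : (d (lA y) : ℤ) = e₂ := by rw [hAz y, if_neg hyP]
    exact_mod_cast (show (d (lB y) : ℤ) < d (lA y) by rw [h1, h2]; exact h12z)
  refine transfer_of_sums d v ε (s := s) hlC hCge hlowA hlowB hA hB hC hAC hBC hs ⟨s, hs, fun j => ?_⟩ ?_ ⟨P, ⟨y, hyP, hylow⟩, ?_⟩
  · -- (B1) with `b = s`: every deficit is `≤ e₂ − e₁ ≤ d (λB s) − e₀`
    rw [← he₀]
    have h1 := hAle j
    have h2 := hBge j
    linarith
  · -- (A2) by counting
    intro U j hjU hUne hsS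
    have hsum1 : ∑ x ∈ U.erase j, ((d (lB x) : ℤ) - d (lA x)) =
        (e₂ - e₁) * (((U.erase j ∩ P).card : ℤ) - ((U.erase j ∩ Q).card : ℤ)) := by
      rw [Finset.sum_congr rfl fun x hx => hr x (fun h => hsS (h ▸ hx)), ← Finset.mul_sum, Finset.sum_sub_distrib,
        Finset.sum_boole, Finset.sum_boole, Finset.filter_mem_eq_inter, Finset.filter_mem_eq_inter]
    have hsum2 : (e₂ - e₁) * (((Uᶜ).card : ℤ) - ((Uᶜ ∩ P).card : ℤ)) ≤ ∑ x ∈ Uᶜ, ((d (lA x) : ℤ) - d c₀) := by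
      have h := Finset.sum_le_sum fun x (_ : x ∈ Uᶜ) => hsur x
      rw [← Finset.mul_sum] at h
      have e : ∑ x ∈ Uᶜ, (if x ∈ P then (0 : ℤ) else 1) = ((Uᶜ).card : ℤ) - ((Uᶜ ∩ P).card : ℤ) := by
        have e1 : ∑ x ∈ Uᶜ, (if x ∈ P then (0 : ℤ) else 1) = ∑ x ∈ Uᶜ, ((1 : ℤ) - (if x ∈ P then (1 : ℤ) else 0)) :=
          Finset.sum_congr rfl fun x _ => by split_ifs <;> simp
        rw [e1, Finset.sum_sub_distrib, Finset.sum_boole, Finset.filter_mem_eq_inter, Finset.sum_const]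
        simp
      rw [e] at h; exact h
    have hδ : (0 : ℤ) < e₂ - e₁ := by linarith
    rw [hsum1]
    exact le_trans (mul_le_mul_of_nonneg_left (count_A2 U P Q hjU hsS hcount) hδ.le) hsum2
  · -- (A3) with `L = P`
    intro U j hjU hUne hjs hgood
    have h0 : (0 : ℤ) ≤ ∑ x ∈ Uᶜ, ((d (lA x) : ℤ) - d c₀) := Finset.sum_nonneg fun x _ => hsur0 x
    have hδ : (0 : ℤ) ≤ e₂ - e₁ := by linarith
    rcases hgood with hjP | ⟨x, hxU, hxP⟩
    · rw [hr j hjs, if_neg hjP]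
      have : ((0 : ℤ) - (if j ∈ Q then (1 : ℤ) else 0)) ≤ 0 := by split_ifs <;> norm_num
      nlinarith
    · have h1 : (e₂ - e₁) * 1 ≤ ∑ x ∈ Uᶜ, ((d (lA x) : ℤ) - d c₀) := by
        refine le_trans ?_ (Finset.single_le_sum (f := fun x => (d (lA x) : ℤ) - d c₀) (fun x _ => hsur0 x) (mem_compl.mpr hxU))
        have := hsur x; rw [if_neg hxP] at this; exact this
      rw [hr j hjs]
      have h2 : ((if j ∈ P then (1 : ℤ) else 0) - (if j ∈ Q then (1 : ℤ) else 0)) ≤ 1 := by split_ifs <;> norm_num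
      nlinarith

/-! ## 3. Corollaries: surplus form of the (2,2)→(1,3) law, and the NESTING LAW -/

/-- **TWO-VALUED TRANSFER LAW WITH SURPLUS** (every arrangement, every `m`): `λA = c₁` on `P`, `c₂` off `P`; `λB = c₃` at `s ∉ Q`, `c₁` on
`Q`, `c₂` elsewhere; `#P + 1 ≤ #Q + [s ∈ P]`; `P_C` `c₀`-heavy and latest ⇒ not all dominant. [this cell] -/
theorem transfer_twoValued_ge (d : Fin K → ℕ) (v ε : Fin m → Fin m → Fin K → ℤ)
    {c₀ c₁ c₂ c₃ : Fin K} (h01 : d c₀ < d c₁) (h12 : d c₁ < d c₂) (h23 : d c₂ < d c₃)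
    {σA σB σC : Equiv.Perm (Fin m)} {lA lB lC : Fin m → Fin K} {s c : Fin m} {P Q : Finset (Fin m)}
    (hPQ : P.card + 1 ≤ Q.card + (if s ∈ P then 1 else 0)) (hsQ : s ∉ Q)
    (hlA : ∀ x, lA x = if x ∈ P then c₁ else c₂)
    (hlB : ∀ x, lB x = if x = s then c₃ else if x ∈ Q then c₁ else c₂)
    (hlC : ∀ x, x ≠ c → lC x = c₀) (hCge : ∀ x, d c₀ ≤ d (lC x))
    {θA θB θC : ℤ} (hA : IsDominant d v ε θA (σA, lA)) (hB : IsDominant d v ε θB (σB, lB)) (hC : IsDominant d v ε θC (σC, lC))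
    (hAC : θA < θC) (hBC : θB < θC) : False := by
  classical
  have hBs : lB s = c₃ := by rw [hlB s, if_pos rfl]
  have hAs : d (lA s) ≤ d c₂ := by rw [hlA s]; split_ifs <;> omega
  refine transfer_twoValued_count d v ε h01 h12 hlA (fun x hx => by rw [hlB x, if_neg hx]) (by rw [hBs]; omega) (by rw [hBs]; omega)
    ?_ hlC hCge hA hB hC hAC hBC
  have h1 : s ∉ Q \ P := fun h => hsQ (mem_sdiff.mp h).1
  have h2 : (if s ∈ P \ Q then 1 else 0) = (if s ∈ P then 1 else 0) := by
    by_cases hP : s ∈ P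
    · rw [if_pos (mem_sdiff.mpr ⟨hP, hsQ⟩), if_pos hP]
    · rw [if_neg (fun h => hP (mem_sdiff.mp h).1), if_neg hP]
  rw [if_neg h1, h2]
  have e1 := card_sdiff_add_card_inter P Q
  have e2 := card_sdiff_add_card_inter Q P
  rw [inter_comm] at e2
  omega

/-- **NESTING LAW.**  `d c₀ < d c₁ < d c₂`; `P_A` (`c₁` on `P`, `c₂` off `P`) and `P_B` (`c₁` on `Q`, `c₂` off `Q`) dominant and earlier than
a dominant `c₀`-heavy `P_C` (`λC ≡ c₀` off one column, `d c₀ ≤ d (λC ·)`); if `#P ≤ #Q` then `P ⊆ Q`. [this cell] -/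
theorem nested_of_dominant (d : Fin K → ℕ) (v ε : Fin m → Fin m → Fin K → ℤ)
    {c₀ c₁ c₂ : Fin K} (h01 : d c₀ < d c₁) (h12 : d c₁ < d c₂)
    {σA σB σC : Equiv.Perm (Fin m)} {lA lB lC : Fin m → Fin K} {c : Fin m} {P Q : Finset (Fin m)} (hPQ : P.card ≤ Q.card)
    (hlA : ∀ x, lA x = if x ∈ P then c₁ else c₂) (hlB : ∀ x, lB x = if x ∈ Q then c₁ else c₂)
    (hlC : ∀ x, x ≠ c → lC x = c₀) (hCge : ∀ x, d c₀ ≤ d (lC x))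
    {θA θB θC : ℤ} (hA : IsDominant d v ε θA (σA, lA)) (hB : IsDominant d v ε θB (σB, lB)) (hC : IsDominant d v ε θC (σC, lC))
    (hAC : θA < θC) (hBC : θB < θC) : P ⊆ Q := by
  classical
  by_contra hnot
  obtain ⟨s, hsP, hsQ⟩ : ∃ s, s ∈ P ∧ s ∉ Q := not_subset.mp hnot
  have hAs : lA s = c₁ := by rw [hlA s, if_pos hsP]
  have hBs : lB s = c₂ := by rw [hlB s, if_neg hsQ]
  refine transfer_twoValued_count d v ε h01 h12 hlA (fun x _ => hlB x) (by rw [hAs, hBs]; exact h12) (by rw [hBs]) ?_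
    hlC hCge hA hB hC hAC hBC
  have h1 : s ∉ Q \ P := fun h => (mem_sdiff.mp h).2 hsP
  rw [if_neg h1, if_pos (mem_sdiff.mpr ⟨hsP, hsQ⟩)]
  have e1 := card_sdiff_add_card_inter P Q
  have e2 := card_sdiff_add_card_inter Q P
  rw [inter_comm] at e2
  omega

end Summit.ValiantsHypothesis.ValiantsHypothesis.Theorems.KPlusLogSqLaw.TopHeavyCore
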